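import Mathlib
import HarnessLib
import Summits.NavierStokesRegularity.NavierStokesRegularity.Theses.LocalOneDirectionTubeDoor
import Summits.NavierStokesRegularity.NavierStokesRegularity.Theorems.LocalSineTubeDoorLocalPointZoomGradSlices
import Summits.NavierStokesRegularity.NavierStokesRegularity.Theorems.LocalSineTubeDoorOneDirectionDoor

/-!
# Route `LocalOneDirectionTubeDoor` (S13, rung N0-LocalTubeDoorOneDirection) — the rung leaf TARGET is a THEOREM

Cell ns-regularity-ideate, seat p6 (birth filing; the route was opened from the staged package
HOME/ns-regularity-ideate-p6/route-onedirection/).  Two independent certificates of the leaf against the born Theses decl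
(closing item stmt-NavierStokesRegularity-20264; capstone for `route close --proved`): `target_proof` = the gate-certified `closes` applied to the two
crux theorems (K1 = `localPointZoomVelGradSlices` p441522; K2 ⇐ `windowCrux_dirDerivNorm` p456214), and
`target_proof_direct` = the door theorem `…Theorems.LocalSineTubeDoorOneDirectionDoor.localTubeDoorOneDirection` (p456214),
whose statement the leaf text copies verbatim.

WHAT THIS IS NOT: not a claim about Navier–Stokes regularity (Clay A).  The leaf is a regularity CRITERION (local Type I
+ L¹-fading of the scale-normalised directional derivative (T−t)·∂ₑu, for every fixed e ≠ 0, on ONE similarity window ⇒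
backward bounded), one rung of LADDER-NS N0 (N0-LocalTubeDoorOneDirection); establishment in the cell's sense still
requires the cross-family referee PASS + independent reproduction.
-/

noncomputable section

-- the summit and its single sub-problem share the name (CONVENTIONS §1), as in every Theorems file
set_option linter.dupNamespace false

namespace Summit.NavierStokesRegularity.NavierStokesRegularity.Theorems.LocalOneDirectionTubeDoorTarget

open Set Literature.Analysis Literature.Analysis.FluidPDE
open Summit.NavierStokesRegularity.NavierStokesRegularity.Theses.LocalOneDirectionTubeDoor
open Summit.NavierStokesRegularity.NavierStokesRegularity.Theorems.LocalSineTubeDoorLocalPointZoomGradSlices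
open Summit.NavierStokesRegularity.NavierStokesRegularity.Theorems.LocalSineTubeDoorProfileAlignedWindowRigidityAncient
open Summit.NavierStokesRegularity.NavierStokesRegularity.Theorems.LocalSineTubeDoorOneDirectionDoor

/-- **The rung leaf `Target` (item stmt-NavierStokesRegularity-20264, rung N0-LocalTubeDoorOneDirection) is a THEOREM**: `closes` applied
to the two crux theorems (both cruxes discharged inline: K1 by `localPointZoomVelGradSlices`, K2 by slice analyticity +
`windowCrux_dirDerivNorm`). -/
theorem target_proof :
    Summit.NavierStokesRegularity.NavierStokesRegularity.Theses.LocalOneDirectionTubeDoor.Target :=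
  closes
    (by
      unfold Summit.NavierStokesRegularity.NavierStokesRegularity.Theses.LocalOneDirectionTubeDoor.LocalPointZoomVelGradSlices
      exact localPointZoomVelGradSlices)
    (by
      intro C v hr hc hm hd
      refine ⟨fun s hs => ?_, fun e he hwin => ?_⟩
      · exact ((analyticOnNhd_slice hc (bdd_of_hasTypeITimeDecay hr) hm hs).contDiff (n := 1)).continuous_fderiv
          one_ne_zero
      · refine windowCrux_dirDerivNorm he C v hr hc hm hd fun s hs => ?_
        obtain ⟨U, hU, hne, hal⟩ := hwin s hs
        exact ⟨U, hU, hne, fun y hy => by simpa only [norm_eq_zero] using hal y hy⟩)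

/-- **Second, glue-independent certificate of the leaf**: the born `Target` text is verbatim the statement of the door
theorem `localTubeDoorOneDirection` (p456214). -/
theorem target_proof_direct :
    Summit.NavierStokesRegularity.NavierStokesRegularity.Theses.LocalOneDirectionTubeDoor.Target :=
  localTubeDoorOneDirection

end Summit.NavierStokesRegularity.NavierStokesRegularity.Theorems.LocalOneDirectionTubeDoorTarget

end
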